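/-
Copyright (c) 2026. All rights reserved.
Released under Apache 2.0 license as described in the file LICENSE.
Authors: abc-iut cell, seat abc-iut-f-197 (block F fact-proving wave, tranche 197; proof-only companion of
abc-iut-L5-t5's `ThetaPMEllNFHodgeTheatersIso.lean`).
-/
import Literature.IUT.HodgeTheaters.KitCoreBridgeWitness
import Literature.IUT.HodgeTheaters.KitS5LocalOfDatumProofs
import Literature.IUT.HodgeTheaters.ThetaPMEllGluingRigidityLaw
import HarnessLib

/-!
# [IUTchI] Rmk 6.12.2 (ii): the FACT-LIST row `S5Local.GluingUniqueBad` at THE named instances — `_holds`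

S. Mochizuki, *Inter-universal Teichmüller theory I*, kurims manuscript (May 2020), §6, Remark 6.12.2 (ii)
p. 174 ("by Proposition 4.8, (ii); Corollary 5.6, (ii), the gluing isomorphism that occurs in such a gluing
operation is unique") and Definition 6.13 (i)(c) p. 182 ("the [necessarily unique!] gluing isomorphism"); §4,
Example 4.4 (iv) p. 107, Proposition 6.7 p. 167 ([IUTchI] Rmk 6.12.2 (ii) p.174) [claim: Mochizuki2012,
status: disputed] (D-0012 claim key, series status DISPUTED; PROOF-ONLY companion — every statement is a
by-name specialisation of landed theorems about the cell's own hypothesis structures; nothing of the series is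
asserted and no side is taken on [IUTchIII] Cor. 3.12 or on abc).

PROOF-ONLY companion (cell abc-iut, seat abc-iut-f-197, F fact-proving wave, FROZEN FACT-LIST row **F-2682**
`S5Local.GluingUniqueBad`; no definition, no statement re-typed; the declaring file
`ThetaPMEllNFHodgeTheatersIso.lean` (abc-iut-L5-t5) is imported, never edited).

The row `GluingUniqueBad (hl) := (𝕍^bad ≠ ∅ → GluingUnique)` is a SCHEMA over an ARBITRARY §6 base kit `K`,
multiplicative kit `M`, `ℱ`-kit `FK` and ΘNF-side kit `N` (plan rule R5): its universal closure is FALSE —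
abc-iut-w4-d056's `exists_kit_not_gluingUniqueBad` (`ThetaPMEllGluingRigidityLaw.lean`: a kit with
`𝕍^bad ≠ ∅` whose Example-4.4 poly-morphisms `thetaPolyBad` are EMPTY, so Proposition 6.7's gluing is not
unique) — hence consumable AT NAMED INSTANCES ONLY.  The uniqueness uses exactly ONE law (GAP-LEDGER
G-w4d056-1, label-rigidity of the bi-saturated `φ^Θ_{v_j}`, Example 4.4 (iv)), which abc-iut-L5-t3's §4 ↔ §6
dictionary DERIVES (`KitCore.thetaPolyBad_labelRigid`, `KitCoreBridge.lean`) for every kit that core-agrees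
with a §4 datum and whose bad-place poly-morphisms ARE Example 4.4's — the Prop-6.7 identification
`KitCore.ThetaAgrees`, the SAME law binder `hγ` the branch-C layer certificate carries for node IUTchI:Prop6.7
(`Summit.ABC.IUTFork.Conditional.layer5_held_prop67`).  THE instance the text prints is precisely such a kit
(Def 6.1 (i): the §6 `𝒟`-prime-strips ARE those of Def 4.1 (i); Prop 6.7: the bad-place poly-morphisms ARE
"the poly-morphisms described … in Example 4.4, (i), (ii)").  This file records, BY NAME:

* `gluingUniqueBad_holds` — **F-2682 HOLDS at THE instance**: for every §4 datum `𝔡`, §6 base kit `K` for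
  `𝔡.l`, kit core `c : KitCore 𝔡 K`, multiplicative kit `M` with `hγ : c.ThetaAgrees M`, every `ℱ`-kit and
  ΘNF-side kit `N`, and every `hl : Odd 𝔡.l`: `N.GluingUniqueBad hl` (abc-iut-L5-t3's `KitCore.gluingUniqueBad`;
  FQ type) — and `gluingUniqueBad_holds'` with `hl` discharged by Def 3.1 (c) (`BaseThetaDatum.odd_l`);
* `gluingUniqueBad_holds_ofDatum` — the same for THE ΘNF-side kit `S5Local.ofDatum` built from abc-iut-L5-t3's
  REAL Definition-5.5 ΘNF-Hodge theaters (`ofDatum_gluingUniqueBad` by name);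
* `gluingUniqueBad_holds_thick` — **UNCONDITIONAL model instance**: over abc-iut-w5's thickened kit
  `K.thicken` with the agreeing multiplicative kit `thickMultKit` (`KitCoreBridgeWitness.lean`:
  `thickCore_thetaAgrees` holds by construction), `GluingUniqueBad` holds for EVERY `ℱ`-kit and ΘNF-side kit
  with NO law hypothesis (`thick_gluingUnique`);
* `gluingUniqueBad_holds_and_not_schema` — the R5 record in one line at every prime `l ≥ 5`: an unconditional
  instance exists AND the universal closure fails.

Fully-qualified types (FQ-TYPE RULE).  Nothing here is new mathematics; typed ≠ proved elsewhere.
-/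

namespace Literature.IUT.HodgeTheaters

open CategoryTheory

universe u

namespace PMBaseKit.S5Local

/-- **FACT-LIST row F-2682 `S5Local.GluingUniqueBad` HOLDS at THE named instance** ([IUTchI] Rmk 6.12.2 (ii)
p. 174: "by Proposition 4.8, (ii); Corollary 5.6, (ii), the gluing isomorphism that occurs in such a gluing
operation is unique"; guarded form `𝕍^bad ≠ ∅ → GluingUnique` of abc-iut-L5-t5): for every §4 datum `𝔡`
(Def 3.1), every §6 base kit `K` for `𝔡.l` that CORE-AGREES with it (`c : KitCore 𝔡 K`, Def 6.1 (i) / Def 4.1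
(i)) and every multiplicative kit `M` whose bad-place poly-morphisms ARE Example 4.4's (`hγ : c.ThetaAgrees M`,
Prop 6.7 p. 167 — the law binder of the branch-C certificate `layer5_held_prop67`), every `ℱ`-kit `FK`,
ΘNF-side kit `N` and `hl : Odd 𝔡.l`: `GluingUniqueBad N hl` — abc-iut-L5-t3's `KitCore.gluingUniqueBad` BY NAME
(the derived label-rigidity law `KitCore.thetaPolyBad_labelRigid` fed to abc-iut-w4-d056's
`gluingUniqueBad_of_forall_bad_labelRigid`).  R5: instance form; the universal closure over arbitrary kits is
false (`exists_kit_not_gluingUniqueBad`). ([IUTchI] Rmk 6.12.2 (ii) p.174) [claim: Mochizuki2012, status: disputed] -/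
theorem gluingUniqueBad_holds {𝔡 : BaseThetaDatum.{u}} {K : PMBaseKit.{u} 𝔡.l} {c : 𝔡.KitCore K}
    {M : K.MultKit} (hγ : c.ThetaAgrees M) {FK : K.FKit M} (N : K.S5Local M FK) (hl : Odd 𝔡.l) :
    Literature.IUT.HodgeTheaters.PMBaseKit.S5Local.GluingUniqueBad (N := N) hl :=
  BaseThetaDatum.KitCore.gluingUniqueBad hγ hl N

/-- `gluingUniqueBad_holds` with the oddness of `l` discharged by Def 3.1 (c) (`l ≥ 5` prime, abc-iut-L5-t3's
`BaseThetaDatum.odd_l`): at THE instance the only hypothesis is the Prop-6.7 law binder `ThetaAgrees`.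
([IUTchI] Rmk 6.12.2 (ii) p.174) [claim: Mochizuki2012, status: disputed] -/
theorem gluingUniqueBad_holds' {𝔡 : BaseThetaDatum.{u}} {K : PMBaseKit.{u} 𝔡.l} {c : 𝔡.KitCore K}
    {M : K.MultKit} (hγ : c.ThetaAgrees M) {FK : K.FKit M} (N : K.S5Local M FK) :
    Literature.IUT.HodgeTheaters.PMBaseKit.S5Local.GluingUniqueBad (N := N) 𝔡.odd_l :=
  gluingUniqueBad_holds hγ N 𝔡.odd_l

/-- **F-2682 at THE ΘNF-side kit of Definition 5.5 theaters**: for the kit `S5Local.ofDatum fc nl` whose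
ΘNF-Hodge theaters are abc-iut-L5-t3's REAL `ThetaNFHodgeTheater S` of [IUTchI] Def 5.5 (iii) (dictionaries
`fc`, `nl`), under the same law binder `ThetaAgrees`: `GluingUniqueBad` — abc-iut-L5-t3's
`ofDatum_gluingUniqueBad` BY NAME. ([IUTchI] Rmk 6.12.2 (ii) p.174) [claim: Mochizuki2012, status: disputed] -/
theorem gluingUniqueBad_holds_ofDatum {𝔡 : BaseThetaDatum.{u+1}} {K : PMBaseKit.{u+1} 𝔡.l}
    {S : BaseThetaDatum.S5Local 𝔡} {c : 𝔡.KitCore K} {M : K.MultKit} {FK : K.FKit M}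
    (fc : S.FKitCore c FK) (nl : c.NFLink) (hγ : c.ThetaAgrees M) (hl : Odd 𝔡.l) :
    Literature.IUT.HodgeTheaters.PMBaseKit.S5Local.GluingUniqueBad
      (N := BaseThetaDatum.S5Local.ofDatum fc nl) hl :=
  BaseThetaDatum.S5Local.ofDatum_gluingUniqueBad fc nl hγ hl

/-- **F-2682, UNCONDITIONAL model instance**: over abc-iut-w5's thickened base kit `K.thicken` (any base kit
`K` at universe `0` for a prime `l ≥ 5` with `𝕍^bad ∩ 𝕍^arc = ∅`, `𝕍^bad ≠ ∅`) with the multiplicative kit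
`thickMultKit` whose `φ^Θ_{v_j}` ARE the thick datum's Example-4.4 poly-morphisms (`thickCore_thetaAgrees`, by
construction), `GluingUniqueBad` holds for EVERY `ℱ`-kit and EVERY ΘNF-side kit with NO law hypothesis —
`thick_gluingUnique` BY NAME (the guard is even superfluous there). ([IUTchI] Rmk 6.12.2 (ii) p.174) [claim: Mochizuki2012, status: disputed] -/
theorem gluingUniqueBad_holds_thick {l : ℕ} [Fact l.Prime] (K : PMBaseKit.{0} l) (hl5 : 5 ≤ l)
    (hdis : Disjoint K.bad K.arc) (hbad : K.bad.Nonempty)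
    {FK : K.thicken.FKit (K.thickMultKit hl5 hdis hbad)}
    (N : K.thicken.S5Local (K.thickMultKit hl5 hdis hbad) FK) (hl : Odd l) :
    Literature.IUT.HodgeTheaters.PMBaseKit.S5Local.GluingUniqueBad (N := N) hl :=
  fun _ => K.thick_gluingUnique hl5 hdis hbad N

/-- **R5 record for F-2682 at every prime `l ≥ 5`**: there is a §6 kit instance (base kit, multiplicative kit)
over which `GluingUniqueBad` holds for ALL `ℱ`-kits and ΘNF-side kits with no hypothesis
(`gluingUniqueBad_holds_thick` over the thickened one-bad-place toy kit of `exists_kitCore_thetaAgrees`), AND the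
universal closure over arbitrary kits FAILS (abc-iut-w4-d056's `exists_kit_not_gluingUniqueBad`): the row is a
genuine constraint on the kit — the label law of Example 4.4 (iv) — consumable at the named instances only.
([IUTchI] Rmk 6.12.2 (ii) p.174) [claim: Mochizuki2012, status: disputed] -/
theorem gluingUniqueBad_holds_and_not_schema (l : ℕ) [Fact l.Prime] (hl5 : 5 ≤ l) (hl : Odd l) :
    (∃ (K : PMBaseKit.{0} l) (M : K.MultKit), ∀ (FK : K.FKit M) (N : K.S5Local M FK),
        Literature.IUT.HodgeTheaters.PMBaseKit.S5Local.GluingUniqueBad (N := N) hl) ∧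
      ∃ (K : PMBaseKit.{0} l) (M : K.MultKit) (FK : K.FKit M) (N : K.S5Local M FK),
        ¬ Literature.IUT.HodgeTheaters.PMBaseKit.S5Local.GluingUniqueBad (N := N) hl := by
  classical
  refine ⟨?_, exists_kit_not_gluingUniqueBad l hl5 hl⟩
  have hl2 : l ≠ 2 := by omega
  let K : PMBaseKit.{0} l := { toyKit l hl2 with bad := ({PUnit.unit} : Finset Unit), arc := ∅ }
  have hdis : Disjoint K.bad K.arc := Finset.disjoint_empty_right _
  have hbad : K.bad.Nonempty := ⟨PUnit.unit, Finset.mem_singleton_self _⟩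
  exact ⟨K.thicken, K.thickMultKit hl5 hdis hbad, fun FK N => gluingUniqueBad_holds_thick K hl5 hdis hbad N hl⟩

end PMBaseKit.S5Local

end Literature.IUT.HodgeTheaters
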